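import Summits.ResolutionOfSingularities.ResolutionOfSingularities.Theorems.HomologicalConductorNoZenoBirthDefs
import Summits.ResolutionOfSingularities.ResolutionOfSingularities.Theorems.HomologicalConductorNoZenoNoetherianCase
import Literature.AlgebraicGeometry.Resolution.Temkin2013Curves
import Literature.AlgebraicGeometry.Resolution.FieldsJ2
import HarnessLib

/-!
# Crux `NoZeno` (stmt-ResolutionOfSingularities-16483), line `birth` (v4) — stub `stub_kernelLowDim`

Route `ResolutionOfSingularities/HomologicalConductor`, crux
`Summit.ResolutionOfSingularities.ResolutionOfSingularities.Theses.HomologicalConductor.NoZeno`.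
Registered stub of the line `birth` (skeleton v4):

  in transcendence degree `≤ 1` the kernel hypothesis — "no noetherian valuation ring dominates
  the canonical tower `T_m = tower O A m`" — is contradictory, so the tower terminates vacuously.

Proof: `O` dominates its own tower (every stage lies in `O`, `mem_valuationSubring_of_mem_tower`;
the unit clause `s⁻¹ ∈ O → s⁻¹ ∈ O` is `id`), and `O` is noetherian: `O = K` is a field, and
`O ≠ K` is a prime divisor (`residueTrdeg + 1 = trdeg`, tree
`residueTrdeg_add_one_eq_of_trdeg_le_one`) of the finitely generated `K/k`
(`(⊤ : IntermediateField k K).FG` from `A.FG` and `Frac A = K`,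
`IntermediateField.fg_top_of_isFractionRing_of_finiteType`), hence a discrete valuation ring
(tree `isDiscreteValuationRing_of_residueTrdeg`, Zariski–Samuel II, VI §14, Thm. 31).
-/

noncomputable section

-- single-problem summit: the doubled namespace component `ResolutionOfSingularities` is forced
set_option linter.dupNamespace false

namespace Summit.ResolutionOfSingularities.ResolutionOfSingularities.Theorems.NoZeno.Birth

open Summit.ResolutionOfSingularities.ResolutionOfSingularities.Theses.HomologicalConductor
open Literature.AlgebraicGeometry.Resolution

/-! ## Noetherianity of valuation rings in transcendence degree `≤ 1` -/

/-- The trivial valuation ring `K° = K` is noetherian (it is a field: transfer along the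
tautological ring isomorphism `K ≃+* ↥O` available when `O = ⊤`). [folklore] -/
theorem isNoetherianRing_of_eq_top {K : Type} [Field K] (O : ValuationSubring K) (hO : O = ⊤) :
    IsNoetherianRing ↥O := by
  have hmem : ∀ x : K, x ∈ O := fun x => hO ▸ ValuationSubring.mem_top x
  let e : K ≃+* ↥O :=
    { toFun := fun x => ⟨x, hmem x⟩
      invFun := fun y => (y : K)
      left_inv := fun _ => rfl
      right_inv := fun _ => rfl
      map_mul' := fun _ _ => rfl
      map_add' := fun _ _ => rfl }
  exact isNoetherianRing_of_ringEquiv K e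

/-- **Every valuation ring `O ∋ k` of a finitely generated `K/k` of transcendence degree `≤ 1`
is noetherian**: `O = K` is a field; `O ≠ K` is a prime divisor
(`residueTrdeg k O + 1 = tr.deg._k K`, by Abhyankar's inequality) and hence a discrete
valuation ring by Zariski–Samuel II, VI §14, Thm. 31 (tree
`isDiscreteValuationRing_of_residueTrdeg`). Here `K = Frac A` for a finitely generated
`k`-subalgebra `A`, which makes `K/k` finitely generated.
[cite: ZariskiSamuel1960, Ch. VI §14, Thm. 31] -/
theorem isNoetherianRing_valuationSubring_of_trdeg_le_one (k K : Type) [Field k] [Field K]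
    [Algebra k K] (O : ValuationSubring K) (A : Subalgebra k K)
    (hk : ∀ c : k, algebraMap k K c ∈ O) (hA : A.FG) (hfr : IsFractionRing ↥A K)
    (htr : Algebra.trdeg k K ≤ 1) : IsNoetherianRing ↥O := by
  by_cases hO : O = ⊤
  · exact isNoetherianRing_of_eq_top O hO
  · haveI : IsFractionRing ↥A K := hfr
    haveI : Algebra.FiniteType k ↥A := A.fg_iff_finiteType.mp hA
    have hfg : (⊤ : IntermediateField k K).FG :=
      IntermediateField.fg_top_of_isFractionRing_of_finiteType k ↥A K
    haveI : IsDiscreteValuationRing ↥O :=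
      isDiscreteValuationRing_of_residueTrdeg O hk hfg hO
        (residueTrdeg_add_one_eq_of_trdeg_le_one O hk hO htr)
    infer_instance

/-! ## The registered stub -/

/-- **STUB `stub_kernelLowDim` (line `birth` of crux `NoZeno`, v4).** In transcendence degree
`≤ 1` every valuation ring `O ∋ k` of the finitely generated `K/k` (`K = Frac A`, `A` a finitely
generated `k`-subalgebra) is noetherian: `O = K` is a field, and `O ≠ K` has
`residueTrdeg + 1 = trdeg` (tree `residueTrdeg_add_one_eq_of_trdeg_le_one`) hence is a discrete
valuation ring (tree `isDiscreteValuationRing_of_residueTrdeg`, Zariski–Samuel II, VI §14,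
Thm. 31; `(⊤ : IntermediateField k K).FG` from `A.FG` by
`IntermediateField.fg_top_of_isFractionRing_of_finiteType`). Since `O` dominates its own tower
(`T_m ⊆ O`, `mem_valuationSubring_of_mem_tower`), the kernel hypothesis `hker O` is
contradicted, so the conclusion holds vacuously. [cite: ZariskiSamuel1960, Ch. VI §14, Thm. 31] -/
theorem stub_kernelLowDim (k K : Type) [Field k] [Field K] [Algebra k K] (O : ValuationSubring K)
    (A : Subalgebra k K) (hk : ∀ c : k, algebraMap k K c ∈ O) (hA : A.FG)
    (hfr : IsFractionRing ↥A K) (hAO : A.toSubring ≤ O.toSubring)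
    (hker : ∀ O' : ValuationSubring K,
      (∀ m : ℕ, ∀ s ∈ tower O A m, s ∈ O' ∧ (s⁻¹ ∈ O' → s⁻¹ ∈ O)) → ¬ IsNoetherianRing ↥O')
    (htr : Algebra.trdeg k K ≤ 1) : ∃ m : ℕ, IsRegularLocalRing ↥(tower O A m) := by
  exfalso
  exact hker O (fun m s hs => ⟨mem_valuationSubring_of_mem_tower O hk hAO m s hs, id⟩)
    (isNoetherianRing_valuationSubring_of_trdeg_le_one k K O A hk hA hfr htr)

end Summit.ResolutionOfSingularities.ResolutionOfSingularities.Theorems.NoZeno.Birth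

end
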